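import Summits.QuantumFields.YangMills.Theorems.LuscherReductionTwistedTraceScalingBTTubeKinetic
import Summits.QuantumFields.YangMills.Theorems.LuscherReductionTwistedTraceScalingGaugeActionRelLinkVec
import HarnessLib

/-!
# The KINETIC coupling of two constant lifts across a gauge fluctuation is EXACT: `Re tr(g_x⁻¹ u g_y u'⁻¹) = g⁰_xg⁰_y·Re tr(uu'⁻¹) + 2g⁰_x·g⃗_y·(u⁻¹u')⃗ − 2g⁰_y·g⃗_x·(u'u⁻¹)⃗ + 2·Quad`,
# and the linear term lives ONLY in the colour sum `Σ_x g⃗_x`: `Σ_e […] = −2Σ_k (Σ_x g⃗_x)·(u⃗_k × u⃗'_k)` (zero on the Faddeev–Popov slice)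
# (lane A of S-BASE, crux `TwistedTraceScaling` stmt-QuantumFields-20203, C4-CORE, the (B-T) pen (F1b); design note `pub/ym-fleet/ym-luscher-20007-p1/COARSE-DESIGN.md` §25.2–§25.3)

Second exact quaternionic identity of the Laplace phase of `fpBOKernel` (after `…BTTubeKinetic`, the fibre direction): the GAUGE direction.  For the constant lifts of two slow
data `u, u'` and ANY gauge transformation `g` of the torus,
* §1 `gaugeQuad p q u u'` — the explicit bilinear form in the vector parts `p = g⃗_x`, `q = g⃗_y`; ★★ `re_trace_inv_mul_mul_mul_inv` — the per-link identity displayed above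
  (product of four unit quaternions; `(u⁻¹u')⃗`, `(u'u⁻¹)⃗` the vector parts of the two relative slow rotations); `gaugeQuad_self : gaugeQuad p q u u = p·Ad(u)q`
  (at `u = u'` the quadratic form is the covariant one and there is NO linear term at all);
* §2 `vecPart_inv_mul_sub_vecPart_mul_inv : (u⁻¹u')⃗ − (u'u⁻¹)⃗ = −2 u⃗ × u⃗'`; ★★ `timeCoupling_constLift_gaugeTransform_constLift` — the exact sum over the torus; ★★
  `gaugeLinear_sum_eq` — the LEADING linear functional `Σ_e [g⃗_{x+k}·(u_k⁻¹u'_k)⃗ − g⃗_x·(u'_ku_k⁻¹)⃗] = −2Σ_k (Σ_x g⃗_x)·(u⃗_k × u⃗'_k)` (telescoping `Σ_x g⃗_{x+k} = Σ_x g⃗_x`,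
  `sum_shift_eq`): it depends on `g` ONLY through the colour sum `Σ_x g⃗_x`, i.e. through the vector part of `Σ_x q(g_x)` — EXACTLY the quantity the weight of record
  `fpWeight` (`…BTColourMean`) pins near `0`; on the slice it VANISHES, on the slab `‖Σ_x g⃗_x‖ ≤ |Site|ε` it is `≤ 2·3·|u⃗||u⃗'|·|Site|ε = O(δ²|Site|β^{-1})` (§25.2).
(The remaining first-order pieces carry the factors `1 − g⁰ = O(|g⃗|²)` and are cubic.)
HONEST FRAMING: exact algebra for a stub of a child of the CONDITIONAL reduction route R2b1; the Laplace core of (B-T) is OPEN; C4-CORE OPEN; not infinite volume, not a gap, not Clay.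
-/

set_option autoImplicit false

noncomputable section

open MeasureTheory Filter Topology Real
open scoped BigOperators Matrix
open Literature.MathematicalPhysics.QuantumFieldTheory
open Literature.MathematicalPhysics.QuantumLattice

namespace Summit.QuantumFields.YangMills.Theorems.FemtoTransferGap.TwoLattice.ConstTube

open Summit.QuantumFields.YangMills.Theorems.FemtoTransferGap
open Summit.QuantumFields.YangMills.Theorems.FemtoTransferGap.TwoLattice.Cov (scalarPart_inv vecPart_inv)

variable {L : ℕ} [NeZero L]

/-! ## §1 One link: four unit quaternions -/

/-- **The bilinear gauge form** of one link: the part of `½Re tr(g_x⁻¹ u g_y u'⁻¹)` bilinear in `(p, q) = (g⃗_x, g⃗_y)`. [folklore] -/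
def gaugeQuad (p q : Fin 3 → ℝ) (u u' : SU2) : ℝ :=
  (p ⬝ᵥ vecPart u) * (q ⬝ᵥ vecPart u') + scalarPart u * scalarPart u' * (p ⬝ᵥ q) - scalarPart u * (p ⬝ᵥ (q ⨯₃ vecPart u')) +
    scalarPart u' * (q ⬝ᵥ (p ⨯₃ vecPart u)) - (p ⨯₃ vecPart u) ⬝ᵥ (q ⨯₃ vecPart u')

/-- ★★ **The link identity**: `Re tr(g⁻¹·u·h·u'⁻¹) = g⁰h⁰·Re tr(uu'⁻¹) + 2g⁰·h⃗·(u⁻¹u')⃗ − 2h⁰·g⃗·(u'u⁻¹)⃗ + 2·gaugeQuad g⃗ h⃗ u u'`. [cite: BrockerTomDieck1985, I (1.10)] -/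
theorem re_trace_inv_mul_mul_mul_inv (g h u u' : SU2) :
    ((su2Rep (g⁻¹ * u * h * u'⁻¹)).trace).re =
      scalarPart g * scalarPart h * ((su2Rep (u * u'⁻¹)).trace).re + 2 * scalarPart g * (vecPart h ⬝ᵥ vecPart (u⁻¹ * u')) -
        2 * scalarPart h * (vecPart g ⬝ᵥ vecPart (u' * u⁻¹)) + 2 * gaugeQuad (vecPart g) (vecPart h) u u' := by
  rw [re_trace_su2Rep_mul_inv, re_trace_su2Rep_mul_inv]
  simp only [scalarPart_mul, vecPart_mul, scalarPart_inv, vecPart_inv]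
  unfold gaugeQuad
  simp only [dotProduct, Fin.sum_univ_three, cross_apply, Pi.add_apply, Pi.smul_apply, Pi.neg_apply, smul_eq_mul, Matrix.cons_val_zero,
    Matrix.cons_val_one, Matrix.head_cons, Matrix.cons_val_two, Matrix.tail_cons, mul_neg, neg_mul, sub_neg_eq_add]
  ring

/-- The quaternion rotation formula in dot-product form: `p·Ad(u)q = (1 − 2|u⃗|²)p·q + 2u⁰ p·(u⃗ × q) + 2(p·u⃗)(u⃗·q)`, here as the identification of the diagonal bilinear gauge form
with it — **`gaugeQuad p q u u = p·(Ad(u) q)`** written out (`u⁰² + |u⃗|² = 1`). [cite: BrockerTomDieck1985, I (1.10)] -/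
theorem gaugeQuad_self (p q : Fin 3 → ℝ) (u : SU2) :
    gaugeQuad p q u u = (scalarPart u ^ 2 - vecPart u ⬝ᵥ vecPart u) * (p ⬝ᵥ q) + 2 * scalarPart u * (p ⬝ᵥ (vecPart u ⨯₃ q)) + 2 * (p ⬝ᵥ vecPart u) * (vecPart u ⬝ᵥ q) := by
  unfold gaugeQuad
  simp only [dotProduct, Fin.sum_univ_three, cross_apply, Matrix.cons_val_zero, Matrix.cons_val_one, Matrix.head_cons, Matrix.cons_val_two, Matrix.tail_cons]
  ring

/-! ## §2 On the torus: the gauge transform of a constant lift -/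

/-- `(u⁻¹u')⃗ − (u'u⁻¹)⃗ = −2 u⃗ × u⃗'`. [folklore] -/
theorem vecPart_inv_mul_sub_vecPart_mul_inv (u u' : SU2) : vecPart (u⁻¹ * u') - vecPart (u' * u⁻¹) = -(2 : ℝ) • (vecPart u ⨯₃ vecPart u') := by
  rw [vecPart_mul, vecPart_mul, scalarPart_inv, vecPart_inv]
  funext a
  fin_cases a <;>
    simp [cross_apply, Pi.sub_apply, Pi.smul_apply, Pi.neg_apply, smul_eq_mul, Matrix.cons_val_zero, Matrix.cons_val_one, Matrix.head_cons,
      Matrix.cons_val_two, Matrix.tail_cons] <;> ring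

omit [NeZero L] in
/-- The link term across a gauge transformation of a constant lift: `Re tr(u_k·((g·constLift u')_e)⁻¹) = Re tr(g_x⁻¹ u_k g_y u'_k⁻¹)`, `e = (x → y)`. [folklore] -/
theorem re_trace_constLift_gaugeTransform (u u' : GaugeConfig 3 1 SU2) (g : Site 3 L → SU2) (e : Edge 3 L) :
    ((su2Rep (constLift L u e * (gaugeTransform g (constLift L u') e)⁻¹)).trace).re =
      ((su2Rep ((g e.1)⁻¹ * u (0, e.2) * g (e.1.shift e.2) * (u' (0, e.2))⁻¹)).trace).re := by
  have h1 : constLift L u e * (gaugeTransform g (constLift L u') e)⁻¹ =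
      (g e.1)⁻¹⁻¹ * ((g e.1)⁻¹ * u (0, e.2) * g (e.1.shift e.2) * (u' (0, e.2))⁻¹) * (g e.1)⁻¹⁻¹⁻¹ := by
    simp only [constLift_apply, gaugeTransform, mul_inv_rev, inv_inv]; group
  rw [h1]
  simp only [show ∀ X : SU2, su2Rep X = (X : Matrix (Fin 2) (Fin 2) ℂ) from fun X => rfl, re_trace_eq_two_mul_scalarPart]
  rw [scalarPart_conj]

/-- ★★ **The kinetic coupling of two constant lifts across a gauge transformation, EXACTLY.** [cite: Luscher1983, §3] -/
theorem timeCoupling_constLift_gaugeTransform_constLift (u u' : GaugeConfig 3 1 SU2) (g : Site 3 L → SU2) :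
    timeCoupling su2Rep (constLift L u) (gaugeTransform g (constLift L u')) =
      ∑ e : Edge 3 L, (scalarPart (g e.1) * scalarPart (g (e.1.shift e.2)) * ((su2Rep (u (0, e.2) * (u' (0, e.2))⁻¹)).trace).re +
        2 * scalarPart (g e.1) * (vecPart (g (e.1.shift e.2)) ⬝ᵥ vecPart ((u (0, e.2))⁻¹ * u' (0, e.2))) -
        2 * scalarPart (g (e.1.shift e.2)) * (vecPart (g e.1) ⬝ᵥ vecPart (u' (0, e.2) * (u (0, e.2))⁻¹)) +
        2 * gaugeQuad (vecPart (g e.1)) (vecPart (g (e.1.shift e.2))) (u (0, e.2)) (u' (0, e.2))) := by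
  unfold timeCoupling
  exact Finset.sum_congr rfl fun e _ => by rw [re_trace_constLift_gaugeTransform, re_trace_inv_mul_mul_mul_inv]

/-- ★★ **The leading linear functional lives in the colour sum**: `Σ_e [g⃗_{x+k}·(u_k⁻¹u'_k)⃗ − g⃗_x·(u'_ku_k⁻¹)⃗] = −2Σ_k (Σ_x g⃗_x)·(u⃗_k × u⃗'_k)` for ANY vector field
`p : Site → ℝ³` in place of `g⃗` (telescoping on the torus). [cite: Luscher1983, §3] -/
theorem gaugeLinear_sum_eq (u u' : GaugeConfig 3 1 SU2) (p : Site 3 L → Fin 3 → ℝ) :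
    ∑ e : Edge 3 L, (p (e.1.shift e.2) ⬝ᵥ vecPart ((u (0, e.2))⁻¹ * u' (0, e.2)) - p e.1 ⬝ᵥ vecPart (u' (0, e.2) * (u (0, e.2))⁻¹)) =
      -(2 : ℝ) * ∑ k : Fin 3, (∑ x : Site 3 L, p x) ⬝ᵥ (vecPart (u (0, k)) ⨯₃ vecPart (u' (0, k))) := by
  rw [Fintype.sum_prod_type, Finset.sum_comm, Finset.mul_sum]
  refine Finset.sum_congr rfl fun k _ => ?_
  rw [Finset.sum_sub_distrib]
  have h1 : ∑ x : Site 3 L, p (x.shift k) ⬝ᵥ vecPart ((u (0, k))⁻¹ * u' (0, k)) = (∑ x : Site 3 L, p x) ⬝ᵥ vecPart ((u (0, k))⁻¹ * u' (0, k)) := by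
    rw [sum_dotProduct, sum_shift_eq L (fun x => p x ⬝ᵥ vecPart ((u (0, k))⁻¹ * u' (0, k))) k]
  have h2 : ∑ x : Site 3 L, p x ⬝ᵥ vecPart (u' (0, k) * (u (0, k))⁻¹) = (∑ x : Site 3 L, p x) ⬝ᵥ vecPart (u' (0, k) * (u (0, k))⁻¹) := by
    rw [sum_dotProduct]
  rw [h1, h2, ← dotProduct_sub, vecPart_inv_mul_sub_vecPart_mul_inv, dotProduct_smul, smul_eq_mul]

/-- ★ **On the Faddeev–Popov slice the leading linear term vanishes**: if `Σ_x p_x = 0` then `Σ_e [p_{x+k}·(u_k⁻¹u'_k)⃗ − p_x·(u'_ku_k⁻¹)⃗] = 0`. [cite: Luscher1983, §3] -/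
theorem gaugeLinear_sum_eq_zero (u u' : GaugeConfig 3 1 SU2) {p : Site 3 L → Fin 3 → ℝ} (hp : ∑ x : Site 3 L, p x = 0) :
    ∑ e : Edge 3 L, (p (e.1.shift e.2) ⬝ᵥ vecPart ((u (0, e.2))⁻¹ * u' (0, e.2)) - p e.1 ⬝ᵥ vecPart (u' (0, e.2) * (u (0, e.2))⁻¹)) = 0 := by
  rw [gaugeLinear_sum_eq, hp]
  simp

/-- ★ **At coincident slow data there is no linear term at all**: `TC(constLift u, g·constLift u) = Σ_e [g⁰_xg⁰_y·2 + 2·gaugeQuad g⃗_x g⃗_y u_k u_k]` — i.e. `2Σ_e (g⁰_xg⁰_y + g⃗_x·Ad(u_k)g⃗_y)`,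
`= 2Σ_e Re⟨q(g_x), Ad_{u_k} q(g_y)⟩`. [cite: Luscher1983, §3] -/
theorem timeCoupling_constLift_gaugeTransform_constLift_self (u : GaugeConfig 3 1 SU2) (g : Site 3 L → SU2) :
    timeCoupling su2Rep (constLift L u) (gaugeTransform g (constLift L u)) =
      ∑ e : Edge 3 L, (2 * (scalarPart (g e.1) * scalarPart (g (e.1.shift e.2))) + 2 * gaugeQuad (vecPart (g e.1)) (vecPart (g (e.1.shift e.2))) (u (0, e.2)) (u (0, e.2))) := by
  rw [timeCoupling_constLift_gaugeTransform_constLift]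
  refine Finset.sum_congr rfl fun e _ => ?_
  have h1 : vecPart ((u (0, e.2))⁻¹ * u (0, e.2)) = 0 := by rw [inv_mul_cancel]; exact PolyakovLift.vecPart_one
  have h2 : vecPart (u (0, e.2) * (u (0, e.2))⁻¹) = 0 := by rw [mul_inv_cancel]; exact PolyakovLift.vecPart_one
  have h3 : ((su2Rep (u (0, e.2) * (u (0, e.2))⁻¹)).trace).re = 2 := by
    rw [re_trace_su2Rep_mul_inv]
    have h := scalarPart_sq_add (u (0, e.2))
    have hd : vecPart (u (0, e.2)) ⬝ᵥ vecPart (u (0, e.2)) = ∑ a, vecPart (u (0, e.2)) a ^ 2 := by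
      simp only [dotProduct, sq]
    rw [hd]; nlinarith [h]
  rw [h1, h2, h3, dotProduct_zero, dotProduct_zero]
  ring

end Summit.QuantumFields.YangMills.Theorems.FemtoTransferGap.TwoLattice.ConstTube

end
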